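import Summits.Ventures.HSemireg.WedgeHankelRecurrenceGaussChebyshevLucasUVGcd

/-!
# Venture HSemireg — **THE MONIC PELL IDENTITY `C_n² − (X² − 4) S_{n−1}² = 4` AND ITS CHARACTERISTIC-`p` CONSEQUENCE `S_{p−1} = (X² − 4)^{(p−1)∕2}` in every commutative ring of odd prime characteristic
# `p`** (the POLYNOMIAL form of Lucas's law `U_p ≡ (D ∕ p) (mod p)`; the integer congruence itself is ALREADY in the tree as `Literature.NumberTheory.LucasSequences.PrimeDivisors.U_prime_cast ∕
# U_prime_cast_eq_legendreSym` for general `P, Q` and is not restated here) — from `C_p = X^p` (N473) and Frobenius, the sign being fixed by the leading coefficients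

HONEST FRAMING. Part of the Lean index of the computation cell `pub-hsemireg` (seat p10 gen 48, Sunday typer «UNIFORM-IN-n»).  Polynomial algebra and arithmetic modulo `p` only; no variety, no
cohomology theory, no sheaf, no Ext group and no semiregularity map is constructed here; nothing here says that HC / HC_CM / HC_AV holds; no Literature fact (unproved `Prop`) is declared or used.
Custodian versions as in `WedgeHankelSiegelIdeal` (1/3).
SOURCES (cited).  R. Lidl, G. L. Mullen, G. Turnwald, *Dickson Polynomials* (1993), Ch. 2 (`E_{p−1}` modulo `p`); É. Lucas, Amer. J. Math. 1 (1878) 184–240, 289–321, §XXI; P. Ribenboim, *My Numbers, My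
Friends* (2000), Ch. 1 (IV.13).
PROOF TYPED HERE.  N481 `chebyshevC_add_sub_C_sub`; Mathlib `C_mul_C`, `C_zero`, `sub_pow_char`, `ZMod.pow_card`, `sq_eq_sq_iff_eq_or_eq_neg`, `mul_left_cancel₀`, `X_pow_sub_C_ne_zero`, `monic_X_pow_sub_C`;
N473 `chebyshevC_eq_X_pow_charP`; N474 `zmod_prime_two_ne_zero_iff`; N465 `chebyshevS_natDegree_monic`.
DEDUP DISCLOSURE (`rg -n 'chebyshevC_sq_sub_S_sq|chebyshevS_pred_eq_pow|chebyshevS_pred_eval_zmod|U_prime_cast' Summits Literature HarnessLib`, 2026-09-04): N474 (`U_{p−1} = (X²−1)^{(p−1)∕2}`);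
`Literature.NumberTheory.LucasSequences.PrimeDivisors.U_prime_cast` IS the integer congruence `U_p ≡ D^{(p−1)∕2}` (general `P, Q`) — cited, not restated; the polynomial statements below are not
in the tree; 0 hits for the 4 names below.

WHAT IS IN THE TREE.  N465, N473, N474, N481; Literature `LucasSequences.PrimeDivisors` ((IV.13)).
THIS FILE (namespace `Summit.Ventures.HSemireg.Wedge.HankelOuter` continued; CHAINED on N483; 0 definitions):
* §1249 **`chebyshevC_sq_sub_S_sq`** (monic Pell, all `n ∈ ℤ`), **`chebyshevS_pred_eq_pow_zmod`**, **`chebyshevS_pred_eq_pow_charP`**, `chebyshevS_pred_eval_zmod`.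
CAVEATS.  `p` odd.  Nothing Ext-side.  New names only.
-/

open Module Polynomial
open scoped Matrix Polynomial

namespace Summit.Ventures.HSemireg.Wedge.HankelOuter

/-! ## §1249. Monic Pell and `S_{p−1} ≡ (X² − 4)^{(p−1)∕2} (mod p)` -/

/-- **Monic Pell identity `C_n² − (X² − 4) S_{n−1}² = 4`** (all `n ∈ ℤ`, every commutative ring). [Lidl–Mullen–Turnwald Ch. 2; this file, §1249] -/
theorem chebyshevC_sq_sub_S_sq {R : Type*} [CommRing R] (n : ℤ) :
    Polynomial.Chebyshev.C R n ^ 2 - (Polynomial.X ^ 2 - 4) * Polynomial.Chebyshev.S R (n - 1) ^ 2 = 4 := by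
  have h1 := chebyshevC_add_sub_C_sub (R := R) n n
  have h2 := Polynomial.Chebyshev.C_mul_C R n n
  rw [sub_self, Polynomial.Chebyshev.C_zero] at h1 h2
  linear_combination h2 + h1

/-- **`S_{p−1} = (X² − 4)^{(p−1)∕2}` in `𝔽_p[X]`** (`p` an odd prime). [Lidl–Mullen–Turnwald Ch. 2; this file, §1249] -/
theorem chebyshevS_pred_eq_pow_zmod (p : ℕ) [hp : Fact p.Prime] (hp2 : p ≠ 2) :
    Polynomial.Chebyshev.S (ZMod p) ((p : ℤ) - 1) = (Polynomial.X ^ 2 - 4) ^ ((p - 1) / 2) := by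
  have hq : p - 1 = 2 * ((p - 1) / 2) := (Nat.two_mul_div_two_of_even (hp.out.even_sub_one hp2)).symm
  have hpell := chebyshevC_sq_sub_S_sq (R := ZMod p) (p : ℤ)
  rw [chebyshevC_eq_X_pow_charP (ZMod p) p] at hpell
  have hfrob : (Polynomial.X ^ 2 - 4 : (ZMod p)[X]) ^ p = (Polynomial.X ^ p) ^ 2 - 4 := by
    rw [sub_pow_char, ← pow_mul, ← pow_mul, mul_comm, show (4 : (ZMod p)[X]) = Polynomial.C 4 from (Polynomial.C_ofNat 4).symm, ← Polynomial.C_pow, ZMod.pow_card]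
  have hpow : (Polynomial.X ^ 2 - 4 : (ZMod p)[X]) * ((Polynomial.X ^ 2 - 4) ^ ((p - 1) / 2)) ^ 2 = (Polynomial.X ^ 2 - 4) ^ p := by
    rw [← pow_mul, mul_comm ((p - 1) / 2) 2, ← hq, ← pow_succ', Nat.sub_add_cancel hp.out.one_le]
  have key : (Polynomial.X ^ 2 - 4 : (ZMod p)[X]) * Polynomial.Chebyshev.S (ZMod p) ((p : ℤ) - 1) ^ 2 =
      (Polynomial.X ^ 2 - 4) * ((Polynomial.X ^ 2 - 4) ^ ((p - 1) / 2)) ^ 2 := by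
    rw [hpow, hfrob]
    linear_combination (-1 : (ZMod p)[X]) * hpell
  have hne : (Polynomial.X ^ 2 - 4 : (ZMod p)[X]) ≠ 0 := by
    rw [show (4 : (ZMod p)[X]) = Polynomial.C 4 from (Polynomial.C_ofNat 4).symm]; exact Polynomial.X_pow_sub_C_ne_zero (by norm_num) (4 : ZMod p)
  rcases sq_eq_sq_iff_eq_or_eq_neg.1 (mul_left_cancel₀ hne key) with h | h
  · exact h
  · -- the sign: both sides are monic, so `1 = −1` would force `2 = 0`
    exfalso
    have hmonic : ((Polynomial.X ^ 2 - 4 : (ZMod p)[X]) ^ ((p - 1) / 2)).Monic := by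
      rw [show (4 : (ZMod p)[X]) = Polynomial.C 4 from (Polynomial.C_ofNat 4).symm]; exact (Polynomial.monic_X_pow_sub_C (4 : ZMod p) two_ne_zero).pow _
    have hlc := congrArg Polynomial.leadingCoeff h
    rw [show (p : ℤ) - 1 = ((p - 1 : ℕ) : ℤ) by rw [Nat.cast_sub hp.out.one_le]; simp, (chebyshevS_natDegree_monic (R := ZMod p) (p - 1)).2.leadingCoeff, leadingCoeff_neg,
      hmonic.leadingCoeff] at hlc
    have h2 : (2 : ZMod p) = 0 := by linear_combination hlc
    exact (zmod_prime_two_ne_zero_iff p).2 hp2 h2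

/-- **`S_{p−1} = (X² − 4)^{(p−1)∕2}` in every commutative ring of odd prime characteristic `p`.** [this file, §1249] -/
theorem chebyshevS_pred_eq_pow_charP (R : Type*) [CommRing R] (p : ℕ) [Fact p.Prime] [CharP R p] (hp2 : p ≠ 2) :
    Polynomial.Chebyshev.S R ((p : ℤ) - 1) = (Polynomial.X ^ 2 - 4) ^ ((p - 1) / 2) := by
  have h := congrArg (Polynomial.map (ZMod.castHom (dvd_refl p) R)) (chebyshevS_pred_eq_pow_zmod p hp2)
  rw [Polynomial.Chebyshev.map_S, Polynomial.map_pow, Polynomial.map_sub, Polynomial.map_pow, Polynomial.map_X, Polynomial.map_ofNat] at h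
  exact h

/-- `S_{p−1}(x) = (x² − 4)^{(p−1)∕2}` for `x ∈ 𝔽_p` (`p` odd) — the polynomial behind `U_p ≡ (D∕p)` (integer form: `Literature…LucasSequences.PrimeDivisors.U_prime_cast`). [this file, §1249] -/
theorem chebyshevS_pred_eval_zmod (p : ℕ) [Fact p.Prime] (hp2 : p ≠ 2) (x : ZMod p) :
    (Polynomial.Chebyshev.S (ZMod p) ((p : ℤ) - 1)).eval x = (x ^ 2 - 4) ^ ((p - 1) / 2) := by
  rw [chebyshevS_pred_eq_pow_zmod p hp2, eval_pow, eval_sub, eval_pow, eval_X, eval_ofNat]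

end Summit.Ventures.HSemireg.Wedge.HankelOuter
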